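import Summits.QuantumFields.YangMills.Theorems.BalabanUVNodesK0ROfStepTokensRCubeB
import Summits.QuantumFields.YangMills.Theorems.BalabanUVNodesK0AllTorusOfStepTokensRFloorB
import Literature.MathematicalPhysics.QuantumFieldTheory.Balaban1983to89.Node00.Record13SignFreeComparabilityOfBetaBox
import Summits.QuantumFields.YangMills.Theorems.BalabanUVNodesN26AtRecord13BetaBoxOfDriftAtSlope
import Literature.MathematicalPhysics.QuantumFieldTheory.Balaban1983to89.Node00.TorusCoverGaugeTokensGuardedB
import Summits.QuantumFields.YangMills.Theorems.BalabanUVNodesN07Thm1Top7FromProp8GuardedB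

/-!
# K0⁷ — Cʷ‴ PART 1: THE (j, c)-GENERIC CORE — K0⁷'s body from [15] Thm 1's (8)-sentence, the (9)-step token AT AN ARBITRARY CUBE LETTER `(M, c) = (L^j, c)` with `c ≤ L^j`,
# and the SIGN-FREE β-BOX of A1's witness `θ₁₅ᶜᶜᴹ(j)`; the stub-level composition with a GENERIC (9)-supplier (the shape the print-cube repair (R-b) instantiates); NODE O's socket

SIBLING MODULE (director-ym №365, R558 FINAL «RENAME-AND-REDIRECT»): this is the NEW module `K0GenericCubeOfStepTokensRB` (namespace `Summit.QuantumFields.YangMills.Theorems.K0GenericCubeOfStepTokensRB`), carrying the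
Stage-2 re-keyed texts of `K0GenericCubeOfStepTokensR` under the SAME short declaration names (every FQN new ⇒ `theorems.append-only` untouched); the old module `K0GenericCubeOfStepTokensR` is NOT edited and becomes
RESIDUE after the seam (R556 attic later); GREEN ON BOTH SIDES OF THE SEAM (director-ym №368 (2)): §2–§3 are re-sourced from chain B's `_hcomp_allTorus` to the LANDED floor-road sibling `…K0AllTorusOfStepTokensRFloorB` ✓p769752
(`Dat := dataSmall7PTopOf F 2`, `hDat := id`) with the Stage-2 seam DISPLAYED as `hseam`; imports := `…K0ROfStepTokensRCubeB` (cube tokens) + `…RFloorB` + Node00 — nothing of chain B's re-typed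
closers and no residue module.  §1 `clausesH_of_absBox` is GENERALISED to any gauge-group rank `N` (the old module states it at `N = 2`) so that no landed statement is restated (`dedup.landed`).

STAGE-2 RE-KEY (seat `pub-ymgap-k0-s1-w3` g9, TRAIN-K0 row K0-T2 file 6∕6; director-ym №343 (D5) ∕ №346 ∕ №354; k0-s1-w1 g9 MANIFEST): (E1) Stage-2 coherence re-key to print's
(2.3) datum (FLAG №16 ∕ LOCATE-HSEAM 5d3298b8d191f169); the (b)-keyed text survives in git history.  Every displayed [15] token of this file — in hypotheses AND in the displayed stub texts —
is now the GUARDED `(bd, Dat)` ᴮ token at the FLOOR guard of its own cube letter `floorGuard F c` (print's «R₁M₁ sufficiently big», p.304 lines 1–2), print's bond datum `lamDatum F`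
([14] (2.3): `lamBondsSeq Ω k`) and the (7)-data predicate of record `dataSmall7PTopOf F 2` — the currency of node00-def-T's Stage-2 chain B (`…CCMWGaugeRAllTorus`'s all-torus closer):
(8) `VariationalThm1RegSepCoP7MGB F 2 (floorGuard F c) (lamDatum F) (dataSmall7PTopOf F 2) B₃ a₀ a₁`, (9)-step `Gauge9RegSepTopStepGB F 2 suppDom (L^j) (floorGuard F c) (lamDatum F) (dataSmall7PTopOf F 2) …`,
stub 1 in its FLOOR-CARRYING ∃-form `∃ (c : ℕ) (B₃ a₀ a₁ : ℝ), 2L² ≤ B₃ ∧ 0 < a₀ ∧ 0 < a₁ ∧ Prop8RegSepTopStepGB F 2 suppDom (floorGuard F c) (lamDatum F) (dataSmall7PTopOf F 2) B₃ a₀ a₁` (there is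
no floor-free ᴮ step token: the V18 floor-free texts of §3 become the R-shaped texts of `…K0AllTorusOfStepTokensRFloor` §4, supplier `hS` with `c ≤ c′ ≤ L^j`; (8) from the step by 53′
`variationalThm1RegSepCoP7MGB_of_prop8TopStepGB_lamDatum`, floor raised by `.of_imp (floorGuard_imp_of_le …)`).  §1 `clausesH_of_absBox` is token-free (now stated for any `N`).  The sanity
`record13SepCoPHBody_of_stubs123A'` now lands on the cube letter `(L^(c+3), max c ((11·4+3L)·L))` via FILE C's guard- and cube-letter-generic `gauge9GB_cube_of_prop8TopStepGB_of_prop6Member` (new bookkeeping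
lemma `max_floor_cube_le_pow`).  Declaration NAMES and binder ORDER unchanged except the floor letter `c` now ∃-bound in `h1` ∕ ∀-bound in `hS` (as in the R edition); the `7M ∕ R` in names
and the prose «(8) ∕ the R step fact» are historical.  Re-keying bookkeeping only — nothing of Bałaban asserted.  [14] = [Balaban1984PropagatorsII].

Cell `pub-ymgap`, seat `pub-ymgap-dag-n21-c` generation 16 (K0⁷ road lineage; plan g79 WORDS-1 (B) l.24699 ∕ WORD-B1-DECLARER l.24860: stub-2 repair of record (R-b),
item (b3) = «n21-c — the Cʷ‴ composition twin of `record13SepCoPHBody_of_stubs123A` at the new letters (how stub 2′ ∧ 3ᴬ′ thread ρ₀ is your display)»).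
`--kind proof --supports stmt-QuantumFields-20541 --as helper`.  NEW leaf over Cʷ″ (p576368); nothing modified; no new named fact; 0 `def`.

WHY.  The repair (R-b) moves [6] Prop. 6 to PRINT's cube class at big-block size `ρ₀` (k0-s2-w2's (b1) `Node00.CarriersB8CubePrint`: `zdCubP 𝔸 L ρ₀`; stub 2′
`∃ ρ₀ B₁ c₁, 1 ≤ ρ₀ ∧ 0 ≤ B₁ ∧ 0 < c₁ ∧ B8.Prop6Printed 4 L B₁ c₁ (zdCubP (MatA 2) L ρ₀ ·)`), and dag-n07-e's (b2) re-derives the floor-carrying (9)-token from it at the floor letter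
`c(ρ₀) = (11·4 + 4·(ρ₀·L))·L` (INTENT-36).  On the K0 road `ρ₀` therefore threads ONLY through the (9)-token's floor letter `c` and the constants — the cube letter stays `M = L^j`, with
`j` chosen so that `c ≤ L^j` — and every K0-side ingredient is ALREADY generic in `(j, c)`: the all-torus closer `exists_k0SepCoPH_thm1CCMW_of_gauge9TopStepR_of_hcomp_allTorus`
(p575996, binder `hc : c ≤ F.L^j`) and Dʷ∕Eʷ's `hcompBoth_theta13OfThm1CCMW_of_betaBoxSignFree_half` (generic `j`).  Cʷ′∕Cʷ″ fixed `(j, c) = (3, (44+3L)·L)` only because FILE 29's bridge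
did.  This file is Cʷ″ with the cube letter FREED: §1 turns ONE abs β-box of `θ₁₅ᶜᶜᴹ(j)` into the sign-free clauses at `θ₁₅ᶜᶜᴹᵂ(j; γ)` (token-free, point-level); §2 is Cʷ″ §1 at an arbitrary
cube letter; §3 composes at stub level with a GENERIC (9)-SUPPLIER hypothesis — «for every family and every guarded `(B₃, a₀, a₁)` carrying Prop. 8's top step, SOME cube letter `(j, c)` with
`c ≤ L^j`, some `B₉ > 0` and a ceiling `0 < a₁′ ≤ a₁` carry the (9)-token» — which (b2) ∘ stub 2′ instantiates at `(j(ρ₀), c(ρ₀), b9OfP·B₃, min a₁ (a0OfP∕B₃))` (PART 2, typed from (b2)'s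
LANDED statements, not before), and which FILE C's `gauge9R_cube_of_prop8TopStep_of_prop6Member` ∘ stub 2 instantiates today at `(3, (44+3L)·L)` (§3 `record13SepCoPHBody_of_stubs123A'`, the
sanity that the generic road specialises to Cʷ″'s).  The price on stub 3 is displayed: the abs β-box is needed at `θ₁₅ᶜᶜᴹ(j)` for the `j` the supplier lands on ⇒ 3ᴬ′ := 3ᴬ GENERIC IN THE
CUBE LETTER (ρ₀-free; 3ᴬ is its instance `(3, (44+3L)·L)`, §3); NODE O's jets-free road is θ-generic, so Cʷ′'s junction lifts verbatim (§4).

CONTENTS.  §1 `clausesH_of_absBox` (point-level, token-free).  §2 ★ `exists_k0H_of_thm1CoP7M_of_gauge9R_of_absBox` (`hc : c ≤ F.L^j`).  §3 ★★ `record13SepCoPHBody_of_stub1_of_gauge9Supplier_of_absBetaBoxAt`,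
`absBetaBoxAt_three_of_absBetaBoxAt`, `record13SepCoPHBody_of_stubs123A'`.  §4 `absBetaBoxAt_of_jetsFreePairAt` (NODE O's socket, (j, c)-generic).

HONEST FRAMING: count-neutral kernel bookkeeping BY NAME; CONDITIONAL compositions whose antecedents are OPEN (A6: not inhabited here — stub 1 = N07's [15] Prop. 8 ∕ Sect. F at objects,
the (9)-supplier = N05's [6] Prop. 6 on print's cubes through (b2), 3ᴬ′ = NODE O, print-STATED [I] §1 p.264 with unpublished proof [II] p.355); nothing of Bałaban asserted; K0⁷ OPEN; V18
(3bcb71246bb7298d) STANDS — 3ᴬ′ is a DISPLAY for the plan's V19, not a re-registration; counts unmoved (typed 28∕28 · discharged 5∕27); one finite 𝕋⁴ programme at fixed ε — NOT continuum ∕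
ℝ⁴ ∕ OS ∕ mass gap ∕ Clay.  [15] = Bałaban, CMP 102 (1985) 277 [Balaban1985Variational]; [6] = CMP 99 (1985) 75 [Balaban1985RegularSpaces]; [III] = CMP 119 (1988) 243 [Balaban1988Convergent];
[I] = CMP 109 (1987) 249 [Balaban1987RG1]; [II] = CMP 122 (1989) 355 [Balaban1989LargeFieldII]; [RG2] = CMP 116 (1988) 1 [Balaban1988RG2Cluster].
-/

noncomputable section

open scoped Matrix.Norms.L2Operator

namespace Summit.QuantumFields.YangMills.Theorems.K0GenericCubeOfStepTokensRB

open Literature.MathematicalPhysics.QuantumFieldTheory.Balaban1983to89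
open Literature.MathematicalPhysics.QuantumFieldTheory.Balaban1983to89.Node00
open Literature.MathematicalPhysics.QuantumFieldTheory.Balaban1983to89.T4Continuum
open Literature.MathematicalPhysics.QuantumFieldTheory.Balaban1983to89.FlowStep
open Literature.MathematicalPhysics.QuantumFieldTheory.Balaban1983to89.Beta.Drift (OneLoopDrift)
open Summit.QuantumFields.BalabanUV.Gaps.BetaContFromD4Chain (AtSlopeCont)
open Summit.QuantumFields.YangMills.BalabanUVNodes.N07Thm1Top7FromProp8GuardedB (variationalThm1RegSepCoP7MGB_of_prop8TopStepGB_lamDatum)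
open Summit.QuantumFields.YangMills.Theorems.K0ROfStepTokensRCubeB (shrunkCeiling_pos gauge9R_cube_of_prop8TopStep_of_prop6Member gauge9GB_cube_of_prop8TopStepGB_of_prop6Member)
open Summit.QuantumFields.YangMills.Theorems.BalabanUVNodesN26AtRecord13BetaBoxOfDriftAtSlope (exists_betaBox_betaOfRecord₁₃_of_jetsFreePair)
open Summit.QuantumFields.YangMills.Theorems.K0AllTorusOfStepTokensRFloorB (exists_k0SepCoPH_thm1CCMW_of_thm1RegSepCoP7MR_of_gauge9TopStepR_of_hcomp_allTorus)

/-! ## §1  ONE abs β-box of `θ₁₅ᶜᶜᴹ(j)` ⟹ the sign-free clauses (hcomp) ∧ (hcompRev) at `θ₁₅ᶜᶜᴹᵂ(j; γ)` — point-level, token-free, generic `j` -/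

section Clauses

variable (F : T4Family) (j : ℕ) {B₃ B₃' a₀ a₁ : ℝ}

/-- **ONE ABS β-BOX ⟹ THE SIGN-FREE CLAUSES, AT ANY INDEX `j` AND ANY GAUGE-GROUP RANK `N`** (the old module states it at `N = 2`): an abs box `−β′ ≤ β₁₃(θ₁₅ᶜᶜᴹ(j; ε₀, ε₂₉)) ≤ β′` on some window `]0, γ₀]` (thresholds chosen with the box) gives, for
`0 ≤ B₃, B₃′, a₀, a₁`, a window `γ ∈ ]0, ½]` with (hcomp) ∧ (hcompRev) along every `γ`-windowed run of `θ₁₅ᶜᶜᴹᵂ(j; γ)` — the window shrink `exists_window_letters_signFree` (Dʷ §0; `0 ≤ β′`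
read off the box at `k = 0`) then Dʷ∕Eʷ's `hcompBoth_theta13OfThm1CCMW_of_betaBoxSignFree_half`.  No (8)∕(9) token is read by this step (Cʷ′ `clausesH_of_absBetaBox` carries them only as
binders).  CONDITIONAL on the box. [cite: Balaban1987RG1, Thm 1 p.259, (0.20) p.256, (1.20)–(1.22) p.264, §1 p.264; Balaban1988Convergent, (2.4)–(2.8) pp.255–256] -/
theorem clausesH_of_absBox {N : ℕ} [NeZero N] (hB : 0 ≤ B₃) (hB' : 0 ≤ B₃') (ha₀ : 0 ≤ a₀) (ha₁ : 0 ≤ a₁)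
    (h : ∃ γ₀ ε₀ ε₂₉ β' : ℝ, 0 < γ₀ ∧ 0 < ε₀ ∧ 0 < ε₂₉ ∧
        BetaLowerH (-β') γ₀ (betaOfRecord₁₃ F N (theta13OfThm1CCM F N j ε₀ ε₂₉ B₃ B₃' a₀ a₁)) ∧
        BetaUpperH β' γ₀ (betaOfRecord₁₃ F N (theta13OfThm1CCM F N j ε₀ ε₂₉ B₃ B₃' a₀ a₁))) :
    ∃ γ ε₀ ε₂₉ : ℝ, 0 < γ ∧ γ ≤ 1 / 2 ∧ 0 < ε₀ ∧ 0 < ε₂₉ ∧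
        (∀ (p : B12.RunParams) (n : ℕ), n ≤ p.K → Step.InInterval (theta13OfThm1CCMW F N j γ ε₀ ε₂₉ B₃ B₃' a₀ a₁).γ n (gOfRecord₁₃ F N (theta13OfThm1CCMW F N j γ ε₀ ε₂₉ B₃ B₃' a₀ a₁) p) → ∀ m, m < n →
          (theta13OfThm1CCMW F N j γ ε₀ ε₂₉ B₃ B₃' a₀ a₁).s2.cR * epsOfRecord (theta13OfThm1CCMW F N j γ ε₀ ε₂₉ B₃ B₃' a₀ a₁).ν (gOfRecord₁₃ F N (theta13OfThm1CCMW F N j γ ε₀ ε₂₉ B₃ B₃' a₀ a₁) p) m ≤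
            2 * ((theta13OfThm1CCMW F N j γ ε₀ ε₂₉ B₃ B₃' a₀ a₁).s2.cR * epsOfRecord (theta13OfThm1CCMW F N j γ ε₀ ε₂₉ B₃ B₃' a₀ a₁).ν (gOfRecord₁₃ F N (theta13OfThm1CCMW F N j γ ε₀ ε₂₉ B₃ B₃' a₀ a₁) p) (m + 1))) ∧
        (∀ (p : B12.RunParams) (n : ℕ), n ≤ p.K → Step.InInterval (theta13OfThm1CCMW F N j γ ε₀ ε₂₉ B₃ B₃' a₀ a₁).γ n (gOfRecord₁₃ F N (theta13OfThm1CCMW F N j γ ε₀ ε₂₉ B₃ B₃' a₀ a₁) p) → ∀ m, m < n →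
          (theta13OfThm1CCMW F N j γ ε₀ ε₂₉ B₃ B₃' a₀ a₁).s2.cR * epsOfRecord (theta13OfThm1CCMW F N j γ ε₀ ε₂₉ B₃ B₃' a₀ a₁).ν (gOfRecord₁₃ F N (theta13OfThm1CCMW F N j γ ε₀ ε₂₉ B₃ B₃' a₀ a₁) p) (m + 1) ≤
            2 * ((theta13OfThm1CCMW F N j γ ε₀ ε₂₉ B₃ B₃' a₀ a₁).s2.cR * epsOfRecord (theta13OfThm1CCMW F N j γ ε₀ ε₂₉ B₃ B₃' a₀ a₁).ν (gOfRecord₁₃ F N (theta13OfThm1CCMW F N j γ ε₀ ε₂₉ B₃ B₃' a₀ a₁) p) m)) := by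
  obtain ⟨γ₀, ε₀, ε₂₉, β', hγ0, hε, hε', hlow, hup⟩ := h
  have hv : (fun _ : Fin (0 + 1) => γ₀) ∈ Box γ₀ 0 := mem_box.mpr fun _ => ⟨hγ0, le_rfl⟩
  have hβ' : 0 ≤ β' := by
    have h1 := hlow 0 _ hv
    have h2 := hup 0 _ hv
    linarith
  obtain ⟨γ, hγpos, hγle, hγhalf, hl, hu⟩ := exists_window_letters_signFree hγ0 hβ'
  exact ⟨γ, ε₀, ε₂₉, hγpos, hγhalf, hε, hε',
    hcompBoth_theta13OfThm1CCMW_of_betaBoxSignFree_half hγhalf hB hB' ha₀ ha₁ (fun k v hv => hlow k v (box_mono hγle k hv))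
      (fun k v hv => hup k v (box_mono hγle k hv)) hl hu⟩

end Clauses

/-! ## §2  ★ K0⁷'s body at `F` from the (8)-sentence, the (9)-token at an arbitrary cube letter `(L^j, c)` with `c ≤ L^j`, and ONE abs β-box of `θ₁₅ᶜᶜᴹ(j)` -/

section Body

variable (F : T4Family) {j c : ℕ}

/-- **★ THE ⁷ K0 BODY FOR `F` AT AN ARBITRARY CUBE LETTER** — `N = 2`, `M = M₁ = L^j`, (9)-floor `c ≤ L^j` (A2ʷ's collar reading), on EVERY family (no `4 ≤ F.m`, no window∕sign
binder): from the guarded tuple `(B₃, B₉, a₀, a₁)` carrying [15] Thm 1's (8)-sentence `VariationalThm1RegSepCoP7M` and the floor-carrying (9)-token `Gauge9RegSepTopStepR … (L^j) c`, and the abs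
β-box of `θ₁₅ᶜᶜᴹ(j)` for THAT tuple, the body follows: §1 gives (hcomp) ∧ (hcompRev) at `θ₁₅ᶜᶜᴹᵂ(j; γ)`, and the all-torus FLOOR-ROAD closer
`K0AllTorusOfStepTokensRFloorB.exists_k0SepCoPH_thm1CCMW_of_thm1RegSepCoP7MR_of_gauge9TopStepR_of_hcomp_allTorus` (✓p769752; generic `(j, c)`, `Dat := dataSmall7PTopOf F 2`, `hDat := id`; the Stage-2
seam DISPLAYED as `hseam`, director-ym №368 (2)) gives the body.  Cʷ″ §1 is the instance `(j, c) = (3, (44+3L)·L)` fed by stubs 1∕2.  CONDITIONAL.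
[cite: Balaban1985Variational, Thm 1 (8)–(9) p.279, (144)–(152) pp.300–301, Prop. 8 p.304; Balaban1988Convergent, Thm 1 p.262, (2.6)–(2.8) pp.255–256, p.257, (2.21) p.258; Balaban1987RG1, Thm 1 p.259, (1.12) p.262, §1 p.264] -/
theorem exists_k0H_of_thm1CoP7M_of_gauge9R_of_absBox
    (hseam : ∀ (θ : Stage13Params F 2) (p : B12.RunParams) (n : ℕ) (s : SeqOfRecord F θ.ν θ.τ9.M (gOfRecord₁₃ F 2 θ p) p.K (n + 1)) (W : B15DeterminingSets.MSField (F.P p.K) (SU 2)),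
      UbgOfRecord₁₃CoP F 2 θ p (n + 1) s W = UbgMSCoPOfRecordB F 2 θ.ν θ.τ9.M (gOfRecord₁₃ F 2 θ p) p.K (n + 1) s W)
    (hc : c ≤ F.L ^ j) {B₃ B₉ a₀ a₁ : ℝ} (hB₃ : 0 ≤ B₃) (hB₉ : 0 ≤ B₉)
    (ha₀ : 0 < a₀) (ha₁ : 0 < a₁) (h15 : VariationalThm1RegSepCoP7MGB F 2 (floorGuard F c) (lamDatum F) (dataSmall7PTopOf F 2) B₃ a₀ a₁)
    (h9 : Gauge9RegSepTopStepGB F 2 (fun ν K Ω => suppDomOfRecord F ν K Ω) (F.L ^ j) (floorGuard F c) (lamDatum F) (dataSmall7PTopOf F 2) B₃ B₉ a₀ a₁)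
    (h3A : ∃ γ₀ ε₀ ε₂₉ β' : ℝ, 0 < γ₀ ∧ 0 < ε₀ ∧ 0 < ε₂₉ ∧
        BetaLowerH (-β') γ₀ (betaOfRecord₁₃ F 2 (theta13OfThm1CCM F 2 j ε₀ ε₂₉ B₃ B₉ a₀ a₁)) ∧
        BetaUpperH β' γ₀ (betaOfRecord₁₃ F 2 (theta13OfThm1CCM F 2 j ε₀ ε₂₉ B₃ B₉ a₀ a₁))) :
    ∃ θ : Stage13HParams F 2, θ.Provisos₁₃SepCoPH F 2 ∧ (θ.ZhUnity F 2 ∧ θ.SlotsNondegenerate₁₃ F 2) ∧ θ.Admissible F 2 := by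
  obtain ⟨γ, ε₀, ε₂₉, hγ0, hγ, hε, hε', hcomp, hcompRev⟩ := clausesH_of_absBox F j hB₃ hB₉ ha₀.le ha₁.le h3A
  exact exists_k0SepCoPH_thm1CCMW_of_thm1RegSepCoP7MR_of_gauge9TopStepR_of_hcomp_allTorus F (Dat := dataSmall7PTopOf F 2) hγ0 hγ hε hε' hB₃ hB₉ ha₀ ha₁ h15 hc h9
    (fun _ _ _ _ _ _ _ _ h => h) hseam hcomp hcompRev

end Body

/-! ## §3  ★★ The stub-level composition with a GENERIC (9)-supplier and 3ᴬ′ (= 3ᴬ generic in the cube letter); Cʷ″'s texts as the instance `(3, (44+3L)·L)` -/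

section Stubs

/-- Bookkeeping for the floor-carrying sanity instance: both the stub's floor `c` and the cube collar letter `(11·4 + 3L)·L` lie below `L^(c+3)` (`c < 2^c ≤ L^c`, `(44+3L)L ≤ L³`, `L > 11`).
[cite: Balaban1985RegularSpaces, (1.130) p.99 (bookkeeping)] -/
theorem max_floor_cube_le_pow (F : T4Family) (c : ℕ) : max c ((11 * 4 + 3 * F.L) * F.L) ≤ F.L ^ (c + 3) := by
  have hL : 11 < F.L := F.hL11
  have hL1 : 1 ≤ F.L := by omega
  refine max_le ?_ ?_
  · calc c ≤ 2 ^ c := Nat.lt_two_pow_self.le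
      _ ≤ F.L ^ c := Nat.pow_le_pow_left (by omega) c
      _ ≤ F.L ^ (c + 3) := Nat.pow_le_pow_right hL1 (by omega)
  · have h2 : 44 + 3 * F.L ≤ F.L * F.L := by nlinarith
    calc (11 * 4 + 3 * F.L) * F.L = (44 + 3 * F.L) * F.L := by ring
      _ ≤ (F.L * F.L) * F.L := Nat.mul_le_mul_right _ h2
      _ = F.L ^ 3 := by ring
      _ ≤ F.L ^ (c + 3) := Nat.pow_le_pow_right hL1 (by omega)

/-- **★★ K0⁷'s BODY AT EVERY FAMILY FROM STUB 1, A GENERIC (9)-SUPPLIER, AND 3ᴬ′** — the shape every cube-letter road instantiates: `h1` = V18 stub 1 VERBATIM ([15] Prop. 8's top step for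
SOME guarded `(B₃, a₀, a₁)`); `hS` = «for every family and every guarded `(B₃, a₀, a₁)` carrying Prop. 8's top step, SOME cube letter `(j, c)` with `c ≤ L^j`, some `B₉ > 0` and a ceiling
`0 < a₁′ ≤ a₁` carry the floor-carrying (9)-token `Gauge9RegSepTopStepR F 2 suppDom (L^j) c B₃ B₉ a₀ a₁′`» (today: FILE C's `gauge9R_cube_of_prop8TopStep_of_prop6Member` ∘ stub 2 at
`(3, (44+3L)·L, b9Of·B₃, min a₁ (a0Of∕B₃))`; under the repair (R-b): dag-n07-e's (b2) ∘ stub 2′ at `(j(ρ₀), (44 + 4ρ₀L)·L, b9OfP·B₃, min a₁ (a0OfP∕B₃))`); `h3A'` = 3ᴬ′ := 3ᴬ GENERIC IN THE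
CUBE LETTER (for every `(j, c)` with `c ≤ L^j` and every guarded tuple carrying (8) and the (9)-token at `(L^j, c)`, an abs β-box of `θ₁₅ᶜᶜᴹ(j)` on some window — ρ₀-FREE).  Proof: stub 1 ⇒ (8) at
the shrunk ceiling (N07's bridge), `hS` ⇒ (9), `h3A'` at that point ⇒ §2.  CONDITIONAL; K0⁷ NOT closed here; nothing of Bałaban asserted; V18 stands (3ᴬ′ is a display for the plan's V19).
[cite: Balaban1985Variational, Thm 1 (8)–(9) p.279, (152) p.301, Prop. 8 p.304; Balaban1985RegularSpaces, Prop. 6 p.99, p.98; Balaban1988Convergent, Thm 1 p.262, (2.6)–(2.8) pp.255–256, p.257; Balaban1987RG1, Thm 1 p.259, §1 p.264] -/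
theorem record13SepCoPHBody_of_stub1_of_gauge9Supplier_of_absBetaBoxAt
    (hseam : ∀ (F : T4Family) (θ : Stage13Params F 2) (p : B12.RunParams) (n : ℕ) (s : SeqOfRecord F θ.ν θ.τ9.M (gOfRecord₁₃ F 2 θ p) p.K (n + 1)) (W : B15DeterminingSets.MSField (F.P p.K) (SU 2)),
      UbgOfRecord₁₃CoP F 2 θ p (n + 1) s W = UbgMSCoPOfRecordB F 2 θ.ν θ.τ9.M (gOfRecord₁₃ F 2 θ p) p.K (n + 1) s W)
    (h1 : ∀ F : T4Family, ∃ (c : ℕ) (B₃ a₀ a₁ : ℝ), 2 * (F.L : ℝ) ^ 2 ≤ B₃ ∧ 0 < a₀ ∧ 0 < a₁ ∧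
      Prop8RegSepTopStepGB F 2 (fun ν K Ω => suppDomOfRecord F ν K Ω) (floorGuard F c) (lamDatum F) (dataSmall7PTopOf F 2) B₃ a₀ a₁)
    (hS : ∀ (F : T4Family) (c : ℕ) (B₃ a₀ a₁ : ℝ), 2 * (F.L : ℝ) ^ 2 ≤ B₃ → 0 < a₀ → 0 < a₁ →
      Prop8RegSepTopStepGB F 2 (fun ν K Ω => suppDomOfRecord F ν K Ω) (floorGuard F c) (lamDatum F) (dataSmall7PTopOf F 2) B₃ a₀ a₁ →
      ∃ (j c' : ℕ) (B₉ a₁' : ℝ), c ≤ c' ∧ c' ≤ F.L ^ j ∧ 0 < B₉ ∧ 0 < a₁' ∧ a₁' ≤ a₁ ∧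
        Gauge9RegSepTopStepGB F 2 (fun ν K Ω => suppDomOfRecord F ν K Ω) (F.L ^ j) (floorGuard F c') (lamDatum F) (dataSmall7PTopOf F 2) B₃ B₉ a₀ a₁')
    (h3A' : ∀ (F : T4Family) (j c : ℕ) (B₃ B₃' a₀ a₁ : ℝ), c ≤ F.L ^ j → 2 * (F.L : ℝ) ^ 2 ≤ B₃ → 0 < B₃' → 0 < a₀ → 0 < a₁ →
      VariationalThm1RegSepCoP7MGB F 2 (floorGuard F c) (lamDatum F) (dataSmall7PTopOf F 2) B₃ a₀ a₁ →
      Gauge9RegSepTopStepGB F 2 (fun ν K Ω => suppDomOfRecord F ν K Ω) (F.L ^ j) (floorGuard F c) (lamDatum F) (dataSmall7PTopOf F 2) B₃ B₃' a₀ a₁ →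
      ∃ γ₀ ε₀ ε₂₉ β' : ℝ, 0 < γ₀ ∧ 0 < ε₀ ∧ 0 < ε₂₉ ∧
        BetaLowerH (-β') γ₀ (betaOfRecord₁₃ F 2 (theta13OfThm1CCM F 2 j ε₀ ε₂₉ B₃ B₃' a₀ a₁)) ∧
        BetaUpperH β' γ₀ (betaOfRecord₁₃ F 2 (theta13OfThm1CCM F 2 j ε₀ ε₂₉ B₃ B₃' a₀ a₁))) :
    ∀ F : T4Family, ∃ θ : Stage13HParams F 2, θ.Provisos₁₃SepCoPH F 2 ∧ (θ.ZhUnity F 2 ∧ θ.SlotsNondegenerate₁₃ F 2) ∧ θ.Admissible F 2 := by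
  intro F
  obtain ⟨c, B₃, a₀, a₁, hB₃, ha₀, ha₁, h8⟩ := h1 F
  have hL : (0 : ℝ) < (F.L : ℝ) := by exact_mod_cast lt_trans Nat.zero_lt_one F.hL.2
  have hBpos : (0 : ℝ) < B₃ := lt_of_lt_of_le (mul_pos two_pos (pow_pos hL 2)) hB₃
  obtain ⟨j, c', B₉, a₁', hcc', hc', hB₉, ha₁', ha₁'le, h9⟩ := hS F c B₃ a₀ a₁ hB₃ ha₀ ha₁ h8
  have h15 : VariationalThm1RegSepCoP7MGB F 2 (floorGuard F c') (lamDatum F) (dataSmall7PTopOf F 2) B₃ a₀ a₁' :=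
    variationalThm1RegSepCoP7MGB_of_prop8TopStepGB_lamDatum hBpos ((h8.of_le le_rfl ha₁'le).of_imp (floorGuard_imp_of_le hcc'))
  exact exists_k0H_of_thm1CoP7M_of_gauge9R_of_absBox F (hseam F) hc' hBpos.le hB₉.le ha₀ ha₁' h15 h9 (h3A' F j c' B₃ B₉ a₀ a₁' hc' hB₃ hB₉ ha₀ ha₁' h15 h9)

/-- **3ᴬ′ ⟹ 3ᴬ** (V18's stub 3 is the instance `(j, c) = (3, (11·4 + 3L)·L)` of the cube-letter-generic text; `(44 + 3L)·L ≤ L³` since `L ≥ 11`). [cite: Balaban1987RG1, §1 p.264 (bookkeeping); Balaban1985RegularSpaces, (1.130) p.99] -/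
theorem absBetaBoxAt_three_of_absBetaBoxAt (F : T4Family)
    (h3A' : ∀ (j c : ℕ) (B₃ B₃' a₀ a₁ : ℝ), c ≤ F.L ^ j → 2 * (F.L : ℝ) ^ 2 ≤ B₃ → 0 < B₃' → 0 < a₀ → 0 < a₁ →
      VariationalThm1RegSepCoP7MGB F 2 (floorGuard F c) (lamDatum F) (dataSmall7PTopOf F 2) B₃ a₀ a₁ →
      Gauge9RegSepTopStepGB F 2 (fun ν K Ω => suppDomOfRecord F ν K Ω) (F.L ^ j) (floorGuard F c) (lamDatum F) (dataSmall7PTopOf F 2) B₃ B₃' a₀ a₁ →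
      ∃ γ₀ ε₀ ε₂₉ β' : ℝ, 0 < γ₀ ∧ 0 < ε₀ ∧ 0 < ε₂₉ ∧
        BetaLowerH (-β') γ₀ (betaOfRecord₁₃ F 2 (theta13OfThm1CCM F 2 j ε₀ ε₂₉ B₃ B₃' a₀ a₁)) ∧
        BetaUpperH β' γ₀ (betaOfRecord₁₃ F 2 (theta13OfThm1CCM F 2 j ε₀ ε₂₉ B₃ B₃' a₀ a₁))) :
    ∀ B₃ B₃' a₀ a₁ : ℝ, 2 * (F.L : ℝ) ^ 2 ≤ B₃ → 0 < B₃' → 0 < a₀ → 0 < a₁ →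
      VariationalThm1RegSepCoP7MGB F 2 (floorGuard F ((11 * 4 + 3 * F.L) * F.L)) (lamDatum F) (dataSmall7PTopOf F 2) B₃ a₀ a₁ →
      Gauge9RegSepTopStepGB F 2 (fun ν K Ω => suppDomOfRecord F ν K Ω) (F.L ^ 3) (floorGuard F ((11 * 4 + 3 * F.L) * F.L)) (lamDatum F) (dataSmall7PTopOf F 2) B₃ B₃' a₀ a₁ →
      ∃ γ₀ ε₀ ε₂₉ β' : ℝ, 0 < γ₀ ∧ 0 < ε₀ ∧ 0 < ε₂₉ ∧
        BetaLowerH (-β') γ₀ (betaOfRecord₁₃ F 2 (theta13OfThm1CCM F 2 3 ε₀ ε₂₉ B₃ B₃' a₀ a₁)) ∧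
        BetaUpperH β' γ₀ (betaOfRecord₁₃ F 2 (theta13OfThm1CCM F 2 3 ε₀ ε₂₉ B₃ B₃' a₀ a₁)) := by
  have hL : 11 < F.L := F.hL11
  have h2 : 44 + 3 * F.L ≤ F.L * F.L := by nlinarith
  have hc : (11 * 4 + 3 * F.L) * F.L ≤ F.L ^ 3 :=
    calc (11 * 4 + 3 * F.L) * F.L = (44 + 3 * F.L) * F.L := by ring
      _ ≤ (F.L * F.L) * F.L := Nat.mul_le_mul_right _ h2
      _ = F.L ^ 3 := by ring
  intro B₃ B₃' a₀ a₁
  exact h3A' 3 ((11 * 4 + 3 * F.L) * F.L) B₃ B₃' a₀ a₁ hc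

/-- **SANITY — THE GENERIC ROAD SPECIALISES TO Cʷ″'s**: V18's stubs 1, 2 VERBATIM and 3ᴬ′ ⟹ K0⁷'s body at every family, through §3's generic composition with the supplier `hS` := FILE C's
`gauge9R_cube_of_prop8TopStep_of_prop6Member` ∘ stub 2 at `(3, (44+3L)·L, b9Of·B₃, min a₁ (a0Of∕B₃))` (dag-n07-e FILE 29 `gauge152R_of_prop6` inside).  CONDITIONAL; nothing asserted.
[cite: Balaban1985Variational, Thm 1 (8)–(9) p.279, (152) p.301, Prop. 8 p.304; Balaban1985RegularSpaces, Prop. 6 p.99; Balaban1988Convergent, Thm 1 p.262, (2.6)–(2.8) pp.255–256; Balaban1987RG1, Thm 1 p.259, §1 p.264] -/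
theorem record13SepCoPHBody_of_stubs123A'
    (hseam : ∀ (F : T4Family) (θ : Stage13Params F 2) (p : B12.RunParams) (n : ℕ) (s : SeqOfRecord F θ.ν θ.τ9.M (gOfRecord₁₃ F 2 θ p) p.K (n + 1)) (W : B15DeterminingSets.MSField (F.P p.K) (SU 2)),
      UbgOfRecord₁₃CoP F 2 θ p (n + 1) s W = UbgMSCoPOfRecordB F 2 θ.ν θ.τ9.M (gOfRecord₁₃ F 2 θ p) p.K (n + 1) s W)
    (h1 : ∀ F : T4Family, ∃ (c : ℕ) (B₃ a₀ a₁ : ℝ), 2 * (F.L : ℝ) ^ 2 ≤ B₃ ∧ 0 < a₀ ∧ 0 < a₁ ∧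
      Prop8RegSepTopStepGB F 2 (fun ν K Ω => suppDomOfRecord F ν K Ω) (floorGuard F c) (lamDatum F) (dataSmall7PTopOf F 2) B₃ a₀ a₁)
    (h2 : ∀ F : T4Family, ∃ B₁ c₁ : ℝ, 0 ≤ B₁ ∧ 0 < c₁ ∧
      (letI : CStarAlgebra (MatA 2) := {}; B8.Prop6Printed 4 (F.L : ℝ) B₁ c₁ (fun i : B8LeafModelZd.ZdIdx 4 F.L => zdCub (MatA 2) F.L i)))
    (h3A' : ∀ (F : T4Family) (j c : ℕ) (B₃ B₃' a₀ a₁ : ℝ), c ≤ F.L ^ j → 2 * (F.L : ℝ) ^ 2 ≤ B₃ → 0 < B₃' → 0 < a₀ → 0 < a₁ →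
      VariationalThm1RegSepCoP7MGB F 2 (floorGuard F c) (lamDatum F) (dataSmall7PTopOf F 2) B₃ a₀ a₁ →
      Gauge9RegSepTopStepGB F 2 (fun ν K Ω => suppDomOfRecord F ν K Ω) (F.L ^ j) (floorGuard F c) (lamDatum F) (dataSmall7PTopOf F 2) B₃ B₃' a₀ a₁ →
      ∃ γ₀ ε₀ ε₂₉ β' : ℝ, 0 < γ₀ ∧ 0 < ε₀ ∧ 0 < ε₂₉ ∧
        BetaLowerH (-β') γ₀ (betaOfRecord₁₃ F 2 (theta13OfThm1CCM F 2 j ε₀ ε₂₉ B₃ B₃' a₀ a₁)) ∧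
        BetaUpperH β' γ₀ (betaOfRecord₁₃ F 2 (theta13OfThm1CCM F 2 j ε₀ ε₂₉ B₃ B₃' a₀ a₁))) :
    ∀ F : T4Family, ∃ θ : Stage13HParams F 2, θ.Provisos₁₃SepCoPH F 2 ∧ (θ.ZhUnity F 2 ∧ θ.SlotsNondegenerate₁₃ F 2) ∧ θ.Admissible F 2 := by
  refine record13SepCoPHBody_of_stub1_of_gauge9Supplier_of_absBetaBoxAt hseam h1 (fun F c B₃ a₀ a₁ hB₃ ha₀ ha₁ h8 => ?_) h3A'
  have hL : (0 : ℝ) < (F.L : ℝ) := by exact_mod_cast lt_trans Nat.zero_lt_one F.hL.2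
  have hBpos : (0 : ℝ) < B₃ := lt_of_lt_of_le (mul_pos two_pos (pow_pos hL 2)) hB₃
  obtain ⟨B₁, c₁, hB₁, hc₁, hP6⟩ := h2 F
  refine ⟨c + 3, max c ((11 * 4 + 3 * F.L) * F.L), b9Of F (F.L ^ (c + 3)) B₁ * B₃, min a₁ (a0Of F 2 (F.L ^ (c + 3)) B₁ c₁ / B₃), le_max_left _ _,
    max_floor_cube_le_pow F c, mul_pos (b9Of_pos (F := F) (F.L ^ (c + 3)) hB₁) hBpos, shrunkCeiling_pos F (F.L ^ (c + 3)) hBpos hB₁ hc₁ ha₁, min_le_left _ _,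
    (gauge9GB_cube_of_prop8TopStepGB_of_prop6Member F hBpos h8 hB₁ hc₁ hP6 (F.L ^ (c + 3))).of_imp fun ν M g K k s h => ?_⟩
  exact ⟨(le_max_left _ _).trans h, (le_max_right _ _).trans h⟩

end Stubs

/-! ## §4  NODE O's socket, cube-letter-generic: the jets-free pair at `θ₁₅ᶜᶜᴹ(j)` supplies 3ᴬ′ at `(j, c)` (N26 BY NAME — θ-generic) -/

section Supplier

/-- **NODE O's JETS-FREE PAIR AT A1's WITNESS `θ₁₅ᶜᶜᴹ(j)` SUPPLIES 3ᴬ′ AT THE CUBE LETTER `(j, c)`** — Cʷ′ `absBetaBox_of_jetsFreePair` with `3 ↦ j` and the (9)-token at `(L^j, c)`;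
N26's `exists_betaBox_betaOfRecord₁₃_of_jetsFreePair` is θ-generic, so the proof is the same two lines.  CONDITIONAL on the pair; NOT proved; no sign; nothing of Bałaban asserted.
[cite: Balaban1987RG1, Thm 2 p.259, §1 p.264, (2.12)–(2.14) p.268, (5.10) p.293; Balaban1988RG2Cluster, Lemma 3 (2.38) p.20; Balaban1985Variational, Thm 1 p.279, Prop. 8 p.304] -/
theorem absBetaBoxAt_of_jetsFreePairAt (F : T4Family) (j c : ℕ)
    (h : ∀ B₃ B₃' a₀ a₁ : ℝ, 2 * (F.L : ℝ) ^ 2 ≤ B₃ → 0 < B₃' → 0 < a₀ → 0 < a₁ →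
      VariationalThm1RegSepCoP7MGB F 2 (floorGuard F c) (lamDatum F) (dataSmall7PTopOf F 2) B₃ a₀ a₁ →
      Gauge9RegSepTopStepGB F 2 (fun ν K Ω => suppDomOfRecord F ν K Ω) (F.L ^ j) (floorGuard F c) (lamDatum F) (dataSmall7PTopOf F 2) B₃ B₃' a₀ a₁ →
      ∃ ε₀ ε₂₉ : ℝ, 0 < ε₀ ∧ 0 < ε₂₉ ∧
        (letI := (theta13OfThm1CCM F 2 j ε₀ ε₂₉ B₃ B₃' a₀ a₁).instVβ₁; letI := (theta13OfThm1CCM F 2 j ε₀ ε₂₉ B₃ B₃' a₀ a₁).instVβ₂;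
         letI := (theta13OfThm1CCM F 2 j ε₀ ε₂₉ B₃ B₃' a₀ a₁).instιβ
         ∃ d A : ℝ, 0 ≤ d ∧
           OneLoopDrift d A (beta0OfMerged (betaMerged F (mergedTermFamilyMatT F 2 (TcanOfRecord F 2)
             (chiFixed29 F 2 (theta13OfThm1CCM F 2 j ε₀ ε₂₉ B₃ B₃' a₀ a₁).ν (theta13OfThm1CCM F 2 j ε₀ ε₂₉ B₃ B₃' a₀ a₁).ε₂₉) (theta13OfThm1CCM F 2 j ε₀ ε₂₉ B₃ B₃' a₀ a₁).εbg)
             (theta13OfThm1CCM F 2 j ε₀ ε₂₉ B₃ B₃' a₀ a₁).ρ8 (theta13OfThm1CCM F 2 j ε₀ ε₂₉ B₃ B₃' a₀ a₁).bV) (theta13OfThm1CCM F 2 j ε₀ ε₂₉ B₃ B₃' a₀ a₁).v₀) ∧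
           ∃ γ₀ : ℝ, 0 < γ₀ ∧ γ₀ ≤ (theta13OfThm1CCM F 2 j ε₀ ε₂₉ B₃ B₃' a₀ a₁).γ ∧
             AtSlopeCont
               (oneLoopSplit_betaOfMerged
                 (betaMerged F (mergedTermFamilyMatT F 2 (TcanOfRecord F 2)
                   (chiFixed29 F 2 (theta13OfThm1CCM F 2 j ε₀ ε₂₉ B₃ B₃' a₀ a₁).ν (theta13OfThm1CCM F 2 j ε₀ ε₂₉ B₃ B₃' a₀ a₁).ε₂₉) (theta13OfThm1CCM F 2 j ε₀ ε₂₉ B₃ B₃' a₀ a₁).εbg)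
                   (theta13OfThm1CCM F 2 j ε₀ ε₂₉ B₃ B₃' a₀ a₁).ρ8 (theta13OfThm1CCM F 2 j ε₀ ε₂₉ B₃ B₃' a₀ a₁).bV)
                 (beta0OfMerged (betaMerged F (mergedTermFamilyMatT F 2 (TcanOfRecord F 2)
                   (chiFixed29 F 2 (theta13OfThm1CCM F 2 j ε₀ ε₂₉ B₃ B₃' a₀ a₁).ν (theta13OfThm1CCM F 2 j ε₀ ε₂₉ B₃ B₃' a₀ a₁).ε₂₉) (theta13OfThm1CCM F 2 j ε₀ ε₂₉ B₃ B₃' a₀ a₁).εbg)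
                   (theta13OfThm1CCM F 2 j ε₀ ε₂₉ B₃ B₃' a₀ a₁).ρ8 (theta13OfThm1CCM F 2 j ε₀ ε₂₉ B₃ B₃' a₀ a₁).bV) (theta13OfThm1CCM F 2 j ε₀ ε₂₉ B₃ B₃' a₀ a₁).v₀)
                 (theta13OfThm1CCM F 2 j ε₀ ε₂₉ B₃ B₃' a₀ a₁).γ)
               γ₀ d)) :
    ∀ B₃ B₃' a₀ a₁ : ℝ, 2 * (F.L : ℝ) ^ 2 ≤ B₃ → 0 < B₃' → 0 < a₀ → 0 < a₁ →
      VariationalThm1RegSepCoP7MGB F 2 (floorGuard F c) (lamDatum F) (dataSmall7PTopOf F 2) B₃ a₀ a₁ →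
      Gauge9RegSepTopStepGB F 2 (fun ν K Ω => suppDomOfRecord F ν K Ω) (F.L ^ j) (floorGuard F c) (lamDatum F) (dataSmall7PTopOf F 2) B₃ B₃' a₀ a₁ →
      ∃ γ₀ ε₀ ε₂₉ β' : ℝ, 0 < γ₀ ∧ 0 < ε₀ ∧ 0 < ε₂₉ ∧
        BetaLowerH (-β') γ₀ (betaOfRecord₁₃ F 2 (theta13OfThm1CCM F 2 j ε₀ ε₂₉ B₃ B₃' a₀ a₁)) ∧
        BetaUpperH β' γ₀ (betaOfRecord₁₃ F 2 (theta13OfThm1CCM F 2 j ε₀ ε₂₉ B₃ B₃' a₀ a₁)) := by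
  intro B₃ B₃' a₀ a₁ hB₃ hB₃' ha₀ ha₁ h15 h9
  obtain ⟨ε₀, ε₂₉, hε, hε', hJ⟩ := h B₃ B₃' a₀ a₁ hB₃ hB₃' ha₀ ha₁ h15 h9
  obtain ⟨γ₀, hγ0, -, β', -, hup, hlow, -⟩ := exists_betaBox_betaOfRecord₁₃_of_jetsFreePair F 2 (theta13OfThm1CCM F 2 j ε₀ ε₂₉ B₃ B₃' a₀ a₁) hJ
  exact ⟨γ₀, ε₀, ε₂₉, β', hγ0, hε, hε', hlow, hup⟩

end Supplier

end Summit.QuantumFields.YangMills.Theorems.K0GenericCubeOfStepTokensRB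

end
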